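import Mathlib.MeasureTheory.Integral.Prod
import Mathlib.MeasureTheory.Constructions.Pi
import Literature.NumberTheory.Transcendental.KZCalculus

/-!
# Values of the triangle and product representations of the rung (Néron duplication, part 3)

Support file for the crux `TorsionLogs.NeronTorsionFlex` (stmt-KontsevichZagierPeriods-13806),
line `NeronDuplication`. The rung `NeronDuplicationChain` speaks about four integral
representations of dimension `2`: two over triangles `{e₁ < z₁ < z₀ < x}` with integrand
`z₁/(√f(z₁)√f(z₀))`, and two over quadrants `{x < z₀, e₁ < z₁}` with a product integrand
`φ(z₀)ψ(z₁)`. This file reduces their VALUES (`KZ.IntegralRep.value`, a Lebesgue integral over a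
subset of `Fin 2 → ℝ`) to one-variable integrals:

* `value_triangle_eq` : `value = ∫_{e₁}^{x} (∫_{e₁}^{a} b db/√f(b)) · (√f(a))⁻¹ da`
  (transport along `MeasurableEquiv.finTwoArrow`, Fubini over the bounding square — integrability
  is part of the datum of an integral representation);
* `value_quadrant_eq` : `value = (∫_{x}^{∞} φ) · (∫_{e₁}^{∞} ψ)` (`MeasureTheory.setIntegral_prod_mul`).

No elliptic functions here; pure measure theory. [cite: KontsevichZagier2001, §1.1]
-/

-- single-conjunct summit: Sub = Summit, so the namespace segment repeats by design (CONVENTIONS §2)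
set_option linter.dupNamespace false

noncomputable section

open Set MeasureTheory
open Literature.NumberTheory.Transcendental

namespace Summit.KontsevichZagierPeriods.KontsevichZagierPeriods.TorsionLogs.NeronDuplication

/-- Transport of a `Fin 2 → ℝ` set integral to `ℝ × ℝ` along `MeasurableEquiv.finTwoArrow`.
[folklore] -/
theorem setIntegral_fin_two_eq_prod (F : (Fin 2 → ℝ) → ℝ) (D : Set (Fin 2 → ℝ)) :
    ∫ z in D, F z = ∫ p in (fun p : ℝ × ℝ => (![p.1, p.2] : Fin 2 → ℝ)) ⁻¹' D,
      F ![p.1, p.2] ∂(volume.prod volume) := by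
  have he : MeasurePreserving (MeasurableEquiv.finTwoArrow (α := ℝ)).symm (volume.prod volume) volume :=
    (volume_preserving_finTwoArrow ℝ).symm
  have h := he.setIntegral_preimage_emb (MeasurableEquiv.finTwoArrow (α := ℝ)).symm.measurableEmbedding F D
  rw [← h]
  rfl

/-- Transport of integrability along `MeasurableEquiv.finTwoArrow`. [folklore] -/
theorem integrableOn_prod_of_fin_two {F : (Fin 2 → ℝ) → ℝ} {D : Set (Fin 2 → ℝ)}
    (hF : IntegrableOn F D volume) :
    IntegrableOn (fun p : ℝ × ℝ => F ![p.1, p.2])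
      ((fun p : ℝ × ℝ => (![p.1, p.2] : Fin 2 → ℝ)) ⁻¹' D) (volume.prod volume) := by
  have he : MeasurePreserving (MeasurableEquiv.finTwoArrow (α := ℝ)).symm (volume.prod volume) volume :=
    (volume_preserving_finTwoArrow ℝ).symm
  have h := (he.integrableOn_comp_preimage
    (MeasurableEquiv.finTwoArrow (α := ℝ)).symm.measurableEmbedding).mpr hF
  exact h

/-- **Value of a quadrant representation with product integrand**: if `r.domain = {x < z₀, e₁ < z₁}`
and `r.integrand = φ(z₀)ψ(z₁)` on it, then `r.value = (∫_{x}^{∞} φ)(∫_{e₁}^{∞} ψ)`.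
[cite: KontsevichZagier2001, §1.1] -/
theorem value_quadrant_eq (x e₁ : ℝ) (φ ψ : ℝ → ℝ) (r : KZ.IntegralRep 2)
    (hdom : r.domain = {z | x < z 0 ∧ e₁ < z 1})
    (hint : EqOn r.integrand (fun z => φ (z 0) * ψ (z 1)) r.domain) :
    r.value = (∫ a in Ioi x, φ a) * (∫ b in Ioi e₁, ψ b) := by
  rw [KZ.IntegralRep.value, setIntegral_congr_fun (KZ.IntegralRep.measurableSet_domain_holds r) hint,
    setIntegral_fin_two_eq_prod]
  have hset : (fun p : ℝ × ℝ => (![p.1, p.2] : Fin 2 → ℝ)) ⁻¹' r.domain = Ioi x ×ˢ Ioi e₁ := by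
    ext p
    simp [hdom, mem_prod]
  rw [hset]
  simp only [Matrix.cons_val_zero, Matrix.cons_val_one]
  exact setIntegral_prod_mul φ ψ (Ioi x) (Ioi e₁)

/-- **Value of a triangle representation**: if `r.domain = {e₁ < z₁ < z₀ < x}` and
`r.integrand = z₁/(√f(z₁)√f(z₀))` on it, then
`r.value = ∫_{e₁}^{x} (∫_{e₁}^{a} b/√f(b) db)(√f(a))⁻¹ da` (Fubini over the square `(e₁, x)²`, using
the integrability carried by `r`). [cite: KontsevichZagier2001, §1.1] -/
theorem value_triangle_eq (x e₁ : ℝ) (f : ℝ → ℝ) (r : KZ.IntegralRep 2)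
    (hdom : r.domain = {z | e₁ < z 1 ∧ z 1 < z 0 ∧ z 0 < x})
    (hint : EqOn r.integrand (fun z => z 1 / (Real.sqrt (f (z 1)) * Real.sqrt (f (z 0)))) r.domain) :
    r.value = ∫ a in Ioo e₁ x, (∫ b in Ioo e₁ a, b / Real.sqrt (f b)) * (Real.sqrt (f a))⁻¹ := by
  set G : ℝ × ℝ → ℝ := fun p => p.2 / (Real.sqrt (f p.2) * Real.sqrt (f p.1)) with hG
  set T : Set (ℝ × ℝ) := {p | e₁ < p.2 ∧ p.2 < p.1 ∧ p.1 < x} with hT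
  have hTm : MeasurableSet T := by
    simp only [hT, setOf_and]
    refine (measurableSet_lt measurable_const measurable_snd).inter
      ((measurableSet_lt measurable_snd measurable_fst).inter
        (measurableSet_lt measurable_fst measurable_const))
  have hset : (fun p : ℝ × ℝ => (![p.1, p.2] : Fin 2 → ℝ)) ⁻¹' r.domain = T := by
    ext p
    simp [hdom, hT]
  -- integrability of `G` on `T`, transported from `r`
  have hGint : IntegrableOn G T (volume.prod volume) := by
    have h := integrableOn_prod_of_fin_two r.integrableOn
    rw [hset] at h
    refine h.congr_fun (fun p hp => ?_) hTm
    have hp' : (![p.1, p.2] : Fin 2 → ℝ) ∈ r.domain := by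
      rw [← hset] at hp; exact hp
    show r.integrand ![p.1, p.2] = G p
    rw [hint hp']
    simp [hG]
  rw [KZ.IntegralRep.value, setIntegral_congr_fun (KZ.IntegralRep.measurableSet_domain_holds r) hint,
    setIntegral_fin_two_eq_prod, hset]
  simp only [Matrix.cons_val_zero, Matrix.cons_val_one]
  change ∫ p in T, G p ∂(volume.prod volume) = _
  -- Fubini over the square
  have hTsub : T ⊆ Ioo e₁ x ×ˢ Ioo e₁ x := by
    intro p hp
    exact ⟨⟨hp.2.1.trans' hp.1 |> fun h => by exact lt_trans hp.1 hp.2.1, hp.2.2⟩,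
      ⟨hp.1, hp.2.1.trans hp.2.2⟩⟩
  have h1 : ∫ p in T, G p ∂(volume.prod volume) =
      ∫ p in Ioo e₁ x ×ˢ Ioo e₁ x, T.indicator G p ∂(volume.prod volume) := by
    rw [setIntegral_indicator hTm, inter_eq_self_of_subset_right hTsub]
  have hind : IntegrableOn (T.indicator G) (Ioo e₁ x ×ˢ Ioo e₁ x) (volume.prod volume) :=
    (integrable_indicator_iff hTm |>.mpr hGint).integrableOn
  rw [h1, setIntegral_prod _ hind]
  refine setIntegral_congr_fun measurableSet_Ioo fun a ha => ?_
  have hfib : ∀ b, T.indicator G (a, b) = (Ioo e₁ a).indicator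
      (fun b => b / Real.sqrt (f b) * (Real.sqrt (f a))⁻¹) b := by
    intro b
    by_cases hb : b ∈ Ioo e₁ a
    · have hab : (a, b) ∈ T := ⟨hb.1, hb.2, ha.2⟩
      rw [indicator_of_mem hab, indicator_of_mem hb, hG]
      simp only
      rw [div_mul_eq_div_div, div_eq_mul_inv (b / Real.sqrt (f b))]
    · have hab : (a, b) ∉ T := fun h => hb ⟨h.1, h.2.1⟩
      rw [indicator_of_notMem hab, indicator_of_notMem hb]
  simp_rw [hfib]
  rw [setIntegral_indicator measurableSet_Ioo,
    show Ioo e₁ x ∩ Ioo e₁ a = Ioo e₁ a from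
      inter_eq_self_of_subset_right (Ioo_subset_Ioo le_rfl ha.2.le),
    integral_mul_const]

end Summit.KontsevichZagierPeriods.KontsevichZagierPeriods.TorsionLogs.NeronDuplication

end
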